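import Summits.QuantumFields.GaugeBoot.BootstrapCertificatesSuN
import HarnessLib

/-!
# The certified bounds converge: the best level-`n` certificate constant tends to the Wilson expectation, monotonically (gauge-boot, L1/L4 supplement)

HONEST FRAMING (cell `pub-gaugeboot`, page 1 of every file): the venture produces certified bounds
on lattice expectations at stated coupling, gauge group, dimension and torus size; NOT a mass gap,
NOT a continuum limit, NOT a string tension; NOT Yang–Mills-summit-bearing (barriers
`FixedCouplingUltralocality`, `PerturbativeInvisibility`). Structural; no rate, no number.

## Content (`SU(N)` on `(ℤ/L)^d`, every `d`, `L ≥ 1`, `N`, every real `β`)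

For a polynomial observable `P` let `hi_n(P) = sup levelValuesSuN N β n P` be the level-`n` SDP upper
bound and `cert_n(P) = inf {c | c • 1 - P ∈ certConeSuN N β n}` the best constant a level-`n`
SOS ⊕ loop-equation certificate proves. Then:

* `levelValues_antitone_suN` — the feasible value sets decrease with the level; ★ `sSup_levelValues_antitone_suN`
  — so `hi_n` is non-increasing (from the level where `P` is an objective on);
* ★★ `hi_n(P) = cert_n(P)` (`sSup_levelValues_eq_sInf_suN`, no duality gap) and
  ★★★ `tendsto_sSup_levelValues_suN`, `tendsto_sInf_certified_suN`: both tend to the Wilson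
  expectation `∫ P dμ_β` as `n → ∞` — THE CERTIFIED UPPER BOUNDS CONVERGE TO THE TRUTH, from above
  (`wilson_le_sInf_certified_suN`); the lower twins `tendsto_sInf_levelValues_suN`.

So the cell's method is not only sound and complete for strict bounds but its optimal certified
constants form a monotone sequence converging to the true expectation (no rate claimed).

References: Lasserre, SIAM J. Optim. 11 (2001) (monotone convergence of the moment/SOS hierarchy
under Putinar's condition — here replaced by uniqueness of the bootstrap solution); Kazakov–Zheng
(2022) Fig. 3 (observed numerically). Folklore.
-/

noncomputable section

open MeasureTheory Filter Topology NormedSpace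
open Literature.MathematicalPhysics.QuantumFieldTheory (LatticeRep Edge GaugeConfig wilsonAction
  wilsonMeasure)
open Literature.MathematicalPhysics.QuantumLattice

namespace Summit.QuantumFields.GaugeBoot

open OrderUnitDuality

section SuN

variable {d L : ℕ} [NeZero L] (N : ℕ) (β : ℝ)

/-- **Higher level, fewer feasible values.** -/
theorem levelValues_antitone_suN (P : C(GaugeConfig d L (Matrix.specialUnitaryGroup (Fin N) ℂ), ℝ)) :
    Antitone fun n => levelValuesSuN (d := d) (L := L) N β n P := by
  intro m n hmn t ht
  obtain ⟨φ, hφ, rfl⟩ := ht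
  exact ⟨φ, hφ.mono _ (wordTruncation_mono _ hmn), rfl⟩

/-- The level-`n` feasible values of an objective of the certificate domain are bounded above and
non-empty (they form a compact interval containing the Wilson value). -/
theorem bddAbove_levelValues_suN {n : ℕ} {P : C(GaugeConfig d L (Matrix.specialUnitaryGroup (Fin N) ℂ), ℝ)}
    (hP : P ∈ certDomainSuN (d := d) (L := L) N β n) :
    BddAbove (levelValuesSuN (d := d) (L := L) N β n P) ∧
      BddBelow (levelValuesSuN (d := d) (L := L) N β n P) ∧
      (levelValuesSuN (d := d) (L := L) N β n P).Nonempty := by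
  obtain ⟨lo, hi, h, hW⟩ := levelValues_eq_Icc_suN N β hP
  rw [h]
  exact ⟨bddAbove_Icc, bddBelow_Icc, ⟨_, hW⟩⟩

/-- ★ **The SDP upper bound is non-increasing in the level** (for `P` an objective from level `n₀`
on, i.e. a test function of word length `≤ 2n₀`). [folklore] -/
theorem sSup_levelValues_antitone_suN {n₀ : ℕ}
    {P : C(GaugeConfig d L (Matrix.specialUnitaryGroup (Fin N) ℂ), ℝ)}
    (hP : P ∈ wordTruncation (ι := Edge d L) (fundamentalLatticeRep N) (n₀ + n₀)) {m n : ℕ}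
    (hm : n₀ ≤ m) (hmn : m ≤ n) :
    sSup (levelValuesSuN (d := d) (L := L) N β n P) ≤ sSup (levelValuesSuN (d := d) (L := L) N β m P) := by
  have hPn : P ∈ certDomainSuN (d := d) (L := L) N β n :=
    mem_certDomainSuN_of_mem_wordTruncation N β (by omega) hP
  have hPm : P ∈ certDomainSuN (d := d) (L := L) N β m :=
    mem_certDomainSuN_of_mem_wordTruncation N β (by omega) hP
  obtain ⟨-, -, hne⟩ := bddAbove_levelValues_suN N β hPn
  obtain ⟨hbdd, -, -⟩ := bddAbove_levelValues_suN N β hPm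
  exact csSup_le_csSup hbdd hne (levelValues_antitone_suN N β P hmn)

/-- ★ **The SDP lower bound is non-decreasing in the level.** [folklore] -/
theorem sInf_levelValues_monotone_suN {n₀ : ℕ}
    {P : C(GaugeConfig d L (Matrix.specialUnitaryGroup (Fin N) ℂ), ℝ)}
    (hP : P ∈ wordTruncation (ι := Edge d L) (fundamentalLatticeRep N) (n₀ + n₀)) {m n : ℕ}
    (hm : n₀ ≤ m) (hmn : m ≤ n) :
    sInf (levelValuesSuN (d := d) (L := L) N β m P) ≤ sInf (levelValuesSuN (d := d) (L := L) N β n P) := by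
  have hPn : P ∈ certDomainSuN (d := d) (L := L) N β n :=
    mem_certDomainSuN_of_mem_wordTruncation N β (by omega) hP
  have hPm : P ∈ certDomainSuN (d := d) (L := L) N β m :=
    mem_certDomainSuN_of_mem_wordTruncation N β (by omega) hP
  obtain ⟨-, -, hne⟩ := bddAbove_levelValues_suN N β hPn
  obtain ⟨-, hbdd, -⟩ := bddAbove_levelValues_suN N β hPm
  exact csInf_le_csInf hbdd hne (levelValues_antitone_suN N β P hmn)

/-- **The Wilson value is below every SDP upper bound and above every SDP lower bound.** -/
theorem wilson_mem_Icc_sInf_sSup_suN {n : ℕ}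
    {P : C(GaugeConfig d L (Matrix.specialUnitaryGroup (Fin N) ℂ), ℝ)}
    (hP : P ∈ certDomainSuN (d := d) (L := L) N β n) :
    sInf (levelValuesSuN (d := d) (L := L) N β n P) ≤
        ∫ U, P U ∂(wilsonMeasure (fundamentalRep (Fin N)) β) ∧
      ∫ U, P U ∂(wilsonMeasure (fundamentalRep (Fin N)) β) ≤
        sSup (levelValuesSuN (d := d) (L := L) N β n P) := by
  obtain ⟨hbdd, hbdd', -⟩ := bddAbove_levelValues_suN N β hP
  exact ⟨csInf_le hbdd' (wilson_mem_levelValues_suN N β n P),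
    le_csSup hbdd (wilson_mem_levelValues_suN N β n P)⟩

/-- ★★★ **The SDP upper bounds converge to the Wilson expectation.** For every polynomial
observable `P`: `sup levelValuesSuN N β n P → ∫ P dμ_β` as `n → ∞`. [folklore] -/
theorem tendsto_sSup_levelValues_suN
    {P : C(GaugeConfig d L (Matrix.specialUnitaryGroup (Fin N) ℂ), ℝ)}
    (hP : P ∈ polyAlgebra (ι := Edge d L) (fundamentalLatticeRep N)) :
    Tendsto (fun n => sSup (levelValuesSuN (d := d) (L := L) N β n P)) atTop
      (𝓝 (∫ U, P U ∂(wilsonMeasure (fundamentalRep (Fin N)) β))) := by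
  set W := ∫ U, P U ∂(wilsonMeasure (d := d) (L := L) (fundamentalRep (Fin N)) β) with hW
  rw [Metric.tendsto_atTop]
  intro ε hε
  obtain ⟨n₁, hn₁⟩ := (levelValues_subset_Icc_suN N β hP (half_pos hε)).exists_forall_of_atTop
  obtain ⟨n₂, hn₂⟩ := (eventually_mem_wordTruncation (fundamentalLatticeRep N) hP).exists_forall_of_atTop
  refine ⟨max n₁ n₂, fun n hn => ?_⟩
  have hPd : P ∈ certDomainSuN (d := d) (L := L) N β n :=
    mem_certDomainSuN_of_mem_wordTruncation N β ((le_max_right n₁ n₂).trans (hn.trans (Nat.le_add_right n n)))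
      (hn₂ n₂ le_rfl)
  obtain ⟨hbdd, -, hne⟩ := bddAbove_levelValues_suN N β hPd
  have hup : sSup (levelValuesSuN (d := d) (L := L) N β n P) ≤ W + ε / 2 :=
    csSup_le hne fun t ht => (hn₁ n ((le_max_left n₁ n₂).trans hn) ht).2
  have hlow : W ≤ sSup (levelValuesSuN (d := d) (L := L) N β n P) := (wilson_mem_Icc_sInf_sSup_suN N β hPd).2
  rw [Real.dist_eq, abs_lt]
  constructor <;> linarith

/-- ★★★ **The SDP lower bounds converge to the Wilson expectation.** [folklore] -/
theorem tendsto_sInf_levelValues_suN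
    {P : C(GaugeConfig d L (Matrix.specialUnitaryGroup (Fin N) ℂ), ℝ)}
    (hP : P ∈ polyAlgebra (ι := Edge d L) (fundamentalLatticeRep N)) :
    Tendsto (fun n => sInf (levelValuesSuN (d := d) (L := L) N β n P)) atTop
      (𝓝 (∫ U, P U ∂(wilsonMeasure (fundamentalRep (Fin N)) β))) := by
  set W := ∫ U, P U ∂(wilsonMeasure (d := d) (L := L) (fundamentalRep (Fin N)) β) with hW
  rw [Metric.tendsto_atTop]
  intro ε hε
  obtain ⟨n₁, hn₁⟩ := (levelValues_subset_Icc_suN N β hP (half_pos hε)).exists_forall_of_atTop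
  obtain ⟨n₂, hn₂⟩ := (eventually_mem_wordTruncation (fundamentalLatticeRep N) hP).exists_forall_of_atTop
  refine ⟨max n₁ n₂, fun n hn => ?_⟩
  have hPd : P ∈ certDomainSuN (d := d) (L := L) N β n :=
    mem_certDomainSuN_of_mem_wordTruncation N β ((le_max_right n₁ n₂).trans (hn.trans (Nat.le_add_right n n)))
      (hn₂ n₂ le_rfl)
  obtain ⟨-, hbdd, hne⟩ := bddAbove_levelValues_suN N β hPd
  have hlow : W - ε / 2 ≤ sInf (levelValuesSuN (d := d) (L := L) N β n P) :=
    le_csInf hne fun t ht => (hn₁ n ((le_max_left n₁ n₂).trans hn) ht).1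
  have hup : sInf (levelValuesSuN (d := d) (L := L) N β n P) ≤ W := (wilson_mem_Icc_sInf_sSup_suN N β hPd).1
  rw [Real.dist_eq, abs_lt]
  constructor <;> linarith

/-- ★★ **The best certified constant is above the truth**: `∫ P dμ_β ≤ inf {c | c • 1 - P ∈ certCone_n}`
(soundness; the set of certified constants is non-empty and bounded below for objectives of the
certificate domain). [folklore] -/
theorem wilson_le_sInf_certified_suN {n : ℕ}
    {P : C(GaugeConfig d L (Matrix.specialUnitaryGroup (Fin N) ℂ), ℝ)}
    (hP : P ∈ certDomainSuN (d := d) (L := L) N β n) :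
    ∫ U, P U ∂(wilsonMeasure (fundamentalRep (Fin N)) β) ≤
      sInf {c : ℝ | c • (1 : C(GaugeConfig d L (Matrix.specialUnitaryGroup (Fin N) ℂ), ℝ)) - P ∈
        certConeSuN (d := d) (L := L) N β n} := by
  rw [← sSup_levelValues_eq_sInf_suN N β hP]
  exact (wilson_mem_Icc_sInf_sSup_suN N β hP).2

/-- ★★★ **The optimal certified upper bounds converge to the Wilson expectation**: for every
polynomial observable `P`, `inf {c | c • 1 - P ∈ certConeSuN N β n} → ∫ P dμ_β` as `n → ∞`
(no duality gap at each level + convergence of the truncated bootstrap). [folklore] -/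
theorem tendsto_sInf_certified_suN
    {P : C(GaugeConfig d L (Matrix.specialUnitaryGroup (Fin N) ℂ), ℝ)}
    (hP : P ∈ polyAlgebra (ι := Edge d L) (fundamentalLatticeRep N)) :
    Tendsto (fun n => sInf {c : ℝ | c • (1 : C(GaugeConfig d L (Matrix.specialUnitaryGroup (Fin N) ℂ), ℝ))
        - P ∈ certConeSuN (d := d) (L := L) N β n}) atTop
      (𝓝 (∫ U, P U ∂(wilsonMeasure (fundamentalRep (Fin N)) β))) := by
  obtain ⟨n₂, hn₂⟩ := (eventually_mem_wordTruncation (fundamentalLatticeRep N) hP).exists_forall_of_atTop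
  refine (tendsto_sSup_levelValues_suN N β hP).congr' ?_
  filter_upwards [eventually_ge_atTop n₂] with n hn
  exact sSup_levelValues_eq_sInf_suN N β
    (mem_certDomainSuN_of_mem_wordTruncation N β (hn.trans (Nat.le_add_right n n)) (hn₂ n₂ le_rfl))

end SuN

end Summit.QuantumFields.GaugeBoot

end
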